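import Summits.AtomisticToContinuum.HydrodynamicLimit.Theses.AntiMazurCoboundaries
import Literature.MathematicalPhysics.KineticTheory.HardSphereEulerProofs
import Literature.MathematicalPhysics.KineticTheory.HardBallErgodicity

/-!
# Line `almost-invariant-duality` — crux `AntiMazurCoboundaries.CorrectorPressureDecay`
(stmt-AtomisticToContinuum-14135)

Skeleton (crux-plan, round 1) of idea card `almost-invariant-duality` (ideator 1; triage r1-1: pass with note).

THE LEVER. At fixed `N, Φ, lag` the corrector problem of the crux is a convex–concave saddle: the pay-off
`𝔓(W, ρ) = 2∫(F − D_W)ρ dG_N − ∫ρ log ρ dG_N` (`D_W = lag⁻¹(W∘Φ_lag − W)`) is affine and σ(L∞,L¹)-continuous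
in `W` on the COST BALL `𝒲 = {|W| ≤ M, ∫e^{4|W|/h₀} dG_N ≤ e^{δ(N+1)}}` (convex, weak*-compact) and concave in
the bounded density `ρ`; Sion's minimax plus the Gibbs variational identity `sup_ρ 𝔓(W,ρ) = log∫e^{2(F−D_W)}`
give the EXACT finite-`N` duality (`CorrectorMinimax`, stub 1, abstract and TRUE): a corrector good against the
Gibbs tilt exists iff EVERY finite-`N` state `ρ` is moved, by some cost-admissible observable of its own, by more
than its entropy excess. Correctors may be chosen STATE BY STATE: the crux becomes the dual statement
`StatewiseDuality` (C⁺, ∀ρ ∃W; the card calls it ALMOST-INVARIANT RIGIDITY), a rigidity of almost-invariant, low-entropy, flux-biased finite-`N` states.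

THE ANCHOR. On the thermodynamic slice (densities measurable w.r.t. the conserved `(P, E) = (Σvᵢ, ½Σ|vᵢ|²)`)
the dual value is a THEOREM: equivalence of ensembles (Diaconis–Freedman) + the crux's orthogonality
`g ⊥ 1, v, |v|²` + Cramér/Varadhan for `(p̂, θ̂)` give `sup [2E_f F − H(f)] = o(N)` iff `κ < κ*` — the certified
`∃κ` floor of the refuters, read positively (`ThermodynamicSliceFloor`, stub 3, TRUE, unconditional: no
ergodicity is needed on the σ(P,E)-measurable slice; fibre ergodicity à la Simányi only enters the OPEN stub as a
tool for the exactly-Φ-invariant residue, for a.e. lag — triage sharpening (i)).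

THE OPEN STUB. `AlmostInvariantRigidity` (stub 4, hardest): for every state, GIVEN the anchor inequality for its
own thermodynamic profile `f = E[ρ | P,E]` (supplied by stub 3 at `δ/2`), produce a witness `W ∈ 𝒲` paying the
rest: the bias of the NON-thermodynamic fluctuation `F − E[F|P,E]` under `ρ` is bounded by conditional entropy
plus the Orlicz almost-invariance price `2E_ρ D_W`. At most crux-strength (C⁺ ⇒ it trivially); its hard slice is
the Cesàro averages of product tilts (triage (ii): the dual of shared 10967); its tools are the card's F-witness
(Fejér combinations of `F∘Φ_s`, static pressure cost), J-witness (`W = ε(h₀/8)log(ρ∘Φ_{−lag}/ρ)`, price = Jeffreys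
divergence per lag = N-body entropy production, which on product tilts is Boltzmann's `D(q)`, closed by the PROVED
linearised gap `hardSphereLinearizedOp_spectralGap_holds`), and lag rigidity `lag ≤ h₀√δ/s_g`.

THE FRAME. `GibbsFlowInvariance` (stub 2, TRUE, = route support HomogeneousInvariance stmt-9621 +
`HardSphereFlow.measurable_flow`) makes `Φ_lag` measure-preserving for `G_N`, which is what stub 1 consumes and what
makes entropy witnesses admissible (`H(Φ_lag#Q | G_N) = H(Q | G_N)`).

Composition (sorry-free): `statewiseDuality_of_parts : GibbsFlowInvariance → ThermodynamicSliceFloor →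
AlmostInvariantRigidity → StatewiseDuality` (quantifier merging: `σ₀ := min`, `κ := min`, `N₀ := max`, anchor at `δ/2`);
`correctorPressureDecay_of_parts : CorrectorMinimax → GibbsFlowInvariance → StatewiseDuality → (crux body)`
(`σ₀ := min σ₁ ½`, clause (A) by the tree theorem `isProbabilityMeasure_localGibbsLaw`, minimax at
`X = Phase N`, `μ = G_N`, `T = Φ.flow lag`, `F = fluxObs`, `c = 4/h₀`, `K = e^{δ(N+1)}`, `B = δ(N+1)`);
`CorrectorPressureDecay_of : CorrectorPressureDecay` BY NAME from the four registered stubs.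
-/

noncomputable section

open MeasureTheory ProbabilityTheory Set Filter Topology
open scoped ENNReal

namespace Summit.AtomisticToContinuum.HydrodynamicLimit.Cruxes.CorrectorPressureDecay.AlmostInvariantDuality

open Literature.MathematicalPhysics.KineticTheory (T3 V3 hsDiameter localGibbsLaw)
open Literature.Analysis.FluidPDE (HardSphereFlow Config configMomentum configEnergy)
open Summit.AtomisticToContinuum.HydrodynamicLimit.Theses.AntiMazurCoboundaries (CorrectorPressureDecay)

/-! ## Frame abbreviations (all reducible; the crux decl is matched by unfolding) -/

/-- Hard-sphere flows of `N + 1` spheres of reduced diameter `σ` on `𝕋³` (the crux's `Φ`). -/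
abbrev Flow (σ : ℝ) (N : ℕ) : Type :=
  HardSphereFlow (Literature.Analysis.FluidPDE.Torus.geometry (Fin 3)) (hsDiameter σ N) (N + 1)

/-- Phase space of `N + 1` spheres on `𝕋³`. -/
abbrev Phase (N : ℕ) : Type := Config (N + 1) (Fin 3) T3

/-- The flow-invariant global Gibbs law `G_N` of the crux (constant profiles `a, u₀, θ`). -/
abbrev gibbs (σ a θ : ℝ) (u₀ : V3) (N : ℕ) (Φ : Flow σ N) : Measure (Phase N) :=
  localGibbsLaw σ (fun _ => a) (fun _ => u₀) (fun _ => θ) N Φ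

/-- The fast one-body observable `F(z) = Σᵢ φ(xᵢ) g((vᵢ − u₀)/√θ)` of the crux. -/
abbrev fluxObs (θ : ℝ) (u₀ : V3) (φ : T3 → ℝ) (g : V3 → ℝ) (N : ℕ) (z : Phase N) : ℝ :=
  ∑ i, φ (z i).1 * g ((Real.sqrt θ)⁻¹ • ((z i).2 - u₀))

/-! ## Stub statements -/

/-- Statement of `stub_correctorMinimax` — **exact finite-volume minimax for the cost-constrained corrector**
(abstract: any probability space, any measure-preserving map `T`, any bounded measurable `F`). If for EVERY
bounded probability density `ρ` some `W` in the cost ball `𝒲 = {|W| ≤ M, ∫e^{c|W|} dμ ≤ K}` has pay-off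
`2∫(F − lag⁻¹(W∘T − W))ρ dμ − ∫ρ log ρ dμ ≤ B`, then ONE `W ∈ 𝒲` has defect pressure `∫e^{2(F − D_W)} dμ ≤ e^B`.
Proof plan: `𝒲` is convex and σ(L∞,L¹)-compact (Banach–Alaoglu for the `M`-ball; the Orlicz sublevel set is convex
and L¹-norm-closed on it, hence weak*-closed); `W ↦ 𝔓(W,ρ)` is affine and weak*-continuous because
`T#(ρμ) ≪ μ` (`T` measure-preserving); `ρ ↦ 𝔓` is concave and L∞-continuous on bounded densities; Sion 1958
(doi:10.2140/pjm.1958.8.171) gives `min_W sup_ρ = sup_ρ inf_W ≤ B`, attained at `W* ∈ L∞`; plugging the Gibbs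
density `ρ* = e^{2G}/∫e^{2G}`, `G = F − D_{W*}` (bounded) gives `log∫e^{2G} ≤ B`; truncate a representative of `W*`
to `[−M, M]` (changes `W*∘T` only on `T⁻¹` of a null set). Degenerate cases (`K < 1`, `M = 0`, `T = id`) hold. -/
def CorrectorMinimax : Prop :=
  ∀ (X : Type) [MeasurableSpace X] (μ : Measure X) [IsProbabilityMeasure μ] (T : X → X),
    MeasurePreserving T μ μ →
    ∀ F : X → ℝ, Measurable F → (∃ C : ℝ, ∀ x, |F x| ≤ C) →
    ∀ (lag c M B : ℝ) (K : ℝ≥0∞), 0 < lag → 0 < c → 0 ≤ M →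
    (∀ ρ : X → ℝ, Measurable ρ → (∀ x, 0 ≤ ρ x) → (∃ C : ℝ, ∀ x, ρ x ≤ C) → ∫ x, ρ x ∂μ = 1 →
      ∃ W : X → ℝ, Measurable W ∧ (∀ x, |W x| ≤ M) ∧
        ∫⁻ x, ENNReal.ofReal (Real.exp (c * |W x|)) ∂μ ≤ K ∧
        2 * ∫ x, (F x - lag⁻¹ * (W (T x) - W x)) * ρ x ∂μ - ∫ x, ρ x * Real.log (ρ x) ∂μ ≤ B) →
    ∃ W : X → ℝ, Measurable W ∧ (∀ x, |W x| ≤ M) ∧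
      ∫⁻ x, ENNReal.ofReal (Real.exp (c * |W x|)) ∂μ ≤ K ∧
      ∫⁻ x, ENNReal.ofReal (Real.exp (2 * (F x - lag⁻¹ * (W (T x) - W x)))) ∂μ ≤ ENNReal.ofReal (Real.exp B)

/-- Statement of `stub_gibbsFlowInvariance` — **the global Gibbs law is invariant under every hard-sphere flow**:
each time-`t` map `Φ.flow t` preserves `G_N = localGibbsLaw σ a u₀ θ N Φ` (constant profiles). This is the route's
support item `HomogeneousInvariance` (stmt-AtomisticToContinuum-9621, `Φ.lawAt G_N t = G_N`) together with
`HardSphereFlow.measurable_flow`; it is what makes `T = Φ.flow lag` admissible in `CorrectorMinimax` and what makes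
entropy witnesses cost-free in entropy (`H(Φ_lag#Q | G_N) = H(Q | G_N)`). -/
def GibbsFlowInvariance : Prop :=
  ∀ (σ a θ : ℝ) (u₀ : V3), 0 < σ → 0 < a → 0 < θ → ∀ (N : ℕ) (Φ : Flow σ N) (t : ℝ),
    MeasurePreserving (Φ.flow t) (gibbs σ a θ u₀ N Φ) (gibbs σ a θ u₀ N Φ)

/-- Statement of `stub_thermodynamicSliceFloor` — **the anchor: the energy–momentum-shell Donsker–Varadhan floor
as a theorem.** In the crux's frame there is a UNIVERSAL amplitude `κ > 0` such that for every admissible `(φ, g)`,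
every `δ > 0` and all `N ≥ N₀(φ, g, δ)`: every bounded probability density `ρ` (w.r.t. `G_N`) has a thermodynamic
profile `f(P, E)` — a bounded measurable version of `E_{G_N}[ρ | P, E]`, pinned by testing against all bounded
measurable functions of `(P, E) = (configMomentum, configEnergy)` — whose dual value is sub-extensive:
`2∫F·f(P,E) dG_N − ∫ f(P,E) log f(P,E) dG_N ≤ δ(N+1)`. Proof plan: existence = `condExp` w.r.t. the comap
σ-algebra + Doob factorisation + clipping to `[0, C]`; the sup over `(P,E)`-measurable densities of `2E_f F − H(f)` is
`log E_{G_N} exp(2E[F | P,E])` (Gibbs principle on σ(P,E)); positions ⊥ velocities under `G_N` and exchangeability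
give `E[F|P,E] = (N+1) φ̄ E[g(ṽ₁)|P,E]`, `φ̄ = ∫φ ∈ [−1,1]`; equivalence of ensembles (Diaconis–Freedman 1987,
`O(1/N)` in total variation) gives `E[g(ṽ₁)|P,E] = Ḡ(p̂, θ̂) + O(κ/N)` with `Ḡ = ∇Ḡ = 0` at `(u₀, θ)` because the
likelihood ratio of nearby Maxwellians is `1 + span{1, v, |v|²} + O(|η|²)` and `g ⊥ 1, v, |v|²`; Cramér for
`(p̂, θ̂)` of i.i.d. Maxwellians with rate `I(p,θ') = |p−u₀|²/2θ + (3/2)(θ'/θ − 1 − log(θ'/θ))` and Varadhan: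
`log E exp((N+1)·2φ̄Ḡ(p̂,θ̂)) ≤ (N+1) sup[2|Ḡ| − I] + o(N) = o(N)` as soon as `2|Ḡ| ≤ I` everywhere, which holds
for `κ < κ*` (quadratic comparison near `(u₀,θ)`, `I ≥ c > 0 ≥ 2κ − c` away). `κ*` depends on nothing (reduced
variables); the refuters' certified floors `0.489` (two-level radial `g`) / `0.977` (10967) are instances. -/
def ThermodynamicSliceFloor : Prop :=
  ∀ (a θ : ℝ) (u₀ : V3), 0 < a → 0 < θ → ∃ σ₀ : ℝ, 0 < σ₀ ∧ ∀ σ : ℝ, 0 < σ → σ < σ₀ →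
    ∃ κ : ℝ, 0 < κ ∧ ∀ (φ : T3 → ℝ) (g : V3 → ℝ), Continuous φ → Continuous g →
      (∀ x, |φ x| ≤ 1) → (∀ v, |g v| ≤ κ) →
      (∀ (c₀ c₂ : ℝ) (b : V3),
        ∫ v, g v * (c₀ + inner ℝ b v + c₂ * ‖v‖ ^ 2) ∂(ProbabilityTheory.stdGaussian V3) = 0) →
      ∀ δ : ℝ, 0 < δ → ∃ N₀ : ℕ, ∀ N : ℕ, N₀ ≤ N → ∀ Φ : Flow σ N,
        ∀ ρ : Phase N → ℝ, Measurable ρ → (∀ z, 0 ≤ ρ z) → (∃ C : ℝ, ∀ z, ρ z ≤ C) →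
          ∫ z, ρ z ∂(gibbs σ a θ u₀ N Φ) = 1 →
          ∃ f : V3 → ℝ → ℝ, Measurable (fun p : V3 × ℝ => f p.1 p.2) ∧ (∀ p e, 0 ≤ f p e) ∧
            (∃ C : ℝ, ∀ p e, f p e ≤ C) ∧
            (∀ B : V3 → ℝ → ℝ, Measurable (fun p : V3 × ℝ => B p.1 p.2) →
              (∃ C : ℝ, ∀ p e, |B p e| ≤ C) →
              ∫ z, B (configMomentum z) (configEnergy z) * ρ z ∂(gibbs σ a θ u₀ N Φ) =
                ∫ z, B (configMomentum z) (configEnergy z) *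
                  f (configMomentum z) (configEnergy z) ∂(gibbs σ a θ u₀ N Φ)) ∧
            2 * ∫ z, fluxObs θ u₀ φ g N z * f (configMomentum z) (configEnergy z) ∂(gibbs σ a θ u₀ N Φ) -
                ∫ z, f (configMomentum z) (configEnergy z) *
                  Real.log (f (configMomentum z) (configEnergy z)) ∂(gibbs σ a θ u₀ N Φ)
              ≤ δ * (N + 1)

/-- Statement of `stub_almostInvariantRigidity` — **the open stub: almost-invariant rigidity, conditional on the
anchor, state by state.** Given the frame fact `GibbsFlowInvariance` (stub 2, which every witness construction uses:
`Φ_lag#G_N = G_N`), in the crux's frame (`τ₀(δ)`, `N₀`, then for `N ≥ N₀` and every flow a `lag > 0` and a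
sup-norm radius `M`): for every bounded probability density `ρ` and every thermodynamic profile `f(P,E)` of `ρ`
(testing characterisation) whose dual value is `≤ (δ/2)(N+1)` (what `ThermodynamicSliceFloor` supplies), there is a
witness `W` in the cost ball `{|W| ≤ M, ∫exp(4|W|/h₀) dG_N ≤ e^{δ(N+1)}}`, `h₀ = τ₀(N+1)^{-1/3}`, with pay-off
`2∫(F − lag⁻¹(W∘Φ_lag − W))ρ dG_N − ∫ρ log ρ dG_N ≤ δ(N+1)`. Equivalently (entropy chain rule
`H(ρ) = H(f(P,E)) + H_fib(ρ)`, `E_ρ F = E_f F + E_G[ρ(F − E[F|P,E])]`): the bias of the NON-thermodynamic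
fluctuation `F − E[F|P,E]` under `ρ` is paid by the conditional entropy of `ρ` given `(P,E)`, by `(δ/2)(N+1)`, and by
the Orlicz almost-invariance price `2E_ρ D_W` — "an almost `Φ_lag`-invariant low-entropy state is almost
thermodynamic as far as fast one-body fluxes are concerned". At most crux-strength (`StatewiseDuality` implies it
by dropping the hypothesis). Tools recorded on the line card: F-witness (Fejér combinations of `F∘Φ_s`: reduces any
state to its Cesàro-averaged bias — the hard slice, dual of shared 10967), J-witness (`W = ε(h₀/8)log(ρ∘Φ_{−lag}/ρ)`,
price `(εh₀/4lag)·J(ρG, Φ_lag#ρG)`; on product tilts = Boltzmann's entropy production `D(q)`, closed near equilibrium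
by the PROVED `hardSphereLinearizedOp_spectralGap_holds`), lag rigidity (`lag ≤ h₀√δ/s_g`), and for the exactly
invariant residue fibre ergodicity (`simanyi_hardBall_ergodic`, unproved named fact; time-`lag` map ergodic on a.e.
`(P,E)`-fibre for a.e. `lag` by Fubini — `lag` is chosen after `Φ`). -/
def AlmostInvariantRigidity : Prop :=
  GibbsFlowInvariance →
  ∀ (a θ : ℝ) (u₀ : V3), 0 < a → 0 < θ → ∃ σ₀ : ℝ, 0 < σ₀ ∧ ∀ σ : ℝ, 0 < σ → σ < σ₀ →
    ∃ κ : ℝ, 0 < κ ∧ ∀ (φ : T3 → ℝ) (g : V3 → ℝ), Continuous φ → Continuous g →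
      (∀ x, |φ x| ≤ 1) → (∀ v, |g v| ≤ κ) →
      (∀ (c₀ c₂ : ℝ) (b : V3),
        ∫ v, g v * (c₀ + inner ℝ b v + c₂ * ‖v‖ ^ 2) ∂(ProbabilityTheory.stdGaussian V3) = 0) →
      ∀ δ : ℝ, 0 < δ → ∃ τ₀ : ℝ, 0 < τ₀ ∧ ∃ N₀ : ℕ, ∀ N : ℕ, N₀ ≤ N → ∀ Φ : Flow σ N,
        ∃ lag : ℝ, 0 < lag ∧ ∃ M : ℝ, 0 ≤ M ∧
          ∀ ρ : Phase N → ℝ, Measurable ρ → (∀ z, 0 ≤ ρ z) → (∃ C : ℝ, ∀ z, ρ z ≤ C) →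
            ∫ z, ρ z ∂(gibbs σ a θ u₀ N Φ) = 1 →
            ∀ f : V3 → ℝ → ℝ, Measurable (fun p : V3 × ℝ => f p.1 p.2) → (∀ p e, 0 ≤ f p e) →
              (∃ C : ℝ, ∀ p e, f p e ≤ C) →
              (∀ B : V3 → ℝ → ℝ, Measurable (fun p : V3 × ℝ => B p.1 p.2) →
                (∃ C : ℝ, ∀ p e, |B p e| ≤ C) →
                ∫ z, B (configMomentum z) (configEnergy z) * ρ z ∂(gibbs σ a θ u₀ N Φ) =
                  ∫ z, B (configMomentum z) (configEnergy z) *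
                    f (configMomentum z) (configEnergy z) ∂(gibbs σ a θ u₀ N Φ)) →
              2 * ∫ z, fluxObs θ u₀ φ g N z * f (configMomentum z) (configEnergy z) ∂(gibbs σ a θ u₀ N Φ) -
                  ∫ z, f (configMomentum z) (configEnergy z) *
                    Real.log (f (configMomentum z) (configEnergy z)) ∂(gibbs σ a θ u₀ N Φ)
                ≤ δ / 2 * (N + 1) →
              ∃ W : Phase N → ℝ, Measurable W ∧ (∀ z, |W z| ≤ M) ∧
                ∫⁻ z, ENNReal.ofReal (Real.exp (4 * (τ₀ * ((N + 1 : ℕ) : ℝ) ^ (-(1 / 3 : ℝ)))⁻¹ * |W z|))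
                    ∂(gibbs σ a θ u₀ N Φ) ≤ ENNReal.ofReal (Real.exp (δ * (N + 1))) ∧
                2 * ∫ z, (fluxObs θ u₀ φ g N z - lag⁻¹ * (W (Φ.flow lag z) - W z)) * ρ z
                    ∂(gibbs σ a θ u₀ N Φ) -
                  ∫ z, ρ z * Real.log (ρ z) ∂(gibbs σ a θ u₀ N Φ) ≤ δ * (N + 1)

/-- **The card's Transfer `C⁺` (ALMOST-INVARIANT DUALITY, finite `N`)** — the dual of the crux in `∀ρ ∃W` form:
in the crux's frame, for every bounded probability density `ρ` w.r.t. `G_N` there is a witness `W` in the cost ball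
`{|W| ≤ M, ∫exp(4|W|/h₀) dG_N ≤ e^{δ(N+1)}}` with `2∫(F − D_W)ρ dG_N − ∫ρ log ρ dG_N ≤ δ(N+1)`, i.e.
`2E_ρ F − H(ρ | G_N) ≤ δ(N+1) + 𝔄_{lag,M}(ρ)` with the Orlicz almost-invariance functional
`𝔄_{lag,M}(ρ) = (2/lag)·sup_{W ∈ 𝒲} ∫W d(Φ_lag#(ρG_N) − ρG_N)` (sup attained: `𝒲` weak*-compact). EQUIVALENT to the
crux (`CorrectorMinimax` ⇐, Gibbs/weak duality ⇒); proved below from stubs 3 + 4. Not itself a stub. -/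
def StatewiseDuality : Prop :=
  ∀ (a θ : ℝ) (u₀ : V3), 0 < a → 0 < θ → ∃ σ₀ : ℝ, 0 < σ₀ ∧ ∀ σ : ℝ, 0 < σ → σ < σ₀ →
    ∃ κ : ℝ, 0 < κ ∧ ∀ (φ : T3 → ℝ) (g : V3 → ℝ), Continuous φ → Continuous g →
      (∀ x, |φ x| ≤ 1) → (∀ v, |g v| ≤ κ) →
      (∀ (c₀ c₂ : ℝ) (b : V3),
        ∫ v, g v * (c₀ + inner ℝ b v + c₂ * ‖v‖ ^ 2) ∂(ProbabilityTheory.stdGaussian V3) = 0) →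
      ∀ δ : ℝ, 0 < δ → ∃ τ₀ : ℝ, 0 < τ₀ ∧ ∃ N₀ : ℕ, ∀ N : ℕ, N₀ ≤ N → ∀ Φ : Flow σ N,
        ∃ lag : ℝ, 0 < lag ∧ ∃ M : ℝ, 0 ≤ M ∧
          ∀ ρ : Phase N → ℝ, Measurable ρ → (∀ z, 0 ≤ ρ z) → (∃ C : ℝ, ∀ z, ρ z ≤ C) →
            ∫ z, ρ z ∂(gibbs σ a θ u₀ N Φ) = 1 →
            ∃ W : Phase N → ℝ, Measurable W ∧ (∀ z, |W z| ≤ M) ∧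
              ∫⁻ z, ENNReal.ofReal (Real.exp (4 * (τ₀ * ((N + 1 : ℕ) : ℝ) ^ (-(1 / 3 : ℝ)))⁻¹ * |W z|))
                  ∂(gibbs σ a θ u₀ N Φ) ≤ ENNReal.ofReal (Real.exp (δ * (N + 1))) ∧
              2 * ∫ z, (fluxObs θ u₀ φ g N z - lag⁻¹ * (W (Φ.flow lag z) - W z)) * ρ z
                  ∂(gibbs σ a θ u₀ N Φ) -
                ∫ z, ρ z * Real.log (ρ z) ∂(gibbs σ a θ u₀ N Φ) ≤ δ * (N + 1)

/-! ## Registered stubs -/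

/-- STUB 1 (size L; TRUE — Sion's minimax theorem and `L∞ = (L¹)*` are not in Mathlib: prove the needed
convex–concave case via Hahn–Banach / Ky Fan, or the finite-σ-algebra reduction by martingale truncation + monotone
limits; `WeakDual.isCompact_polar`, `MeasureTheory.Measure.tilted`). Infrastructure that also formalises the
disprover's weak-duality kill criterion (crux NOTES S7). Sources: Sion1958 doi:10.2140/pjm.1958.8.171;
KipnisLandim1999 App. 1 §8 (entropy variational formula); Israel 1979 Ch. I–II. -/
theorem stub_correctorMinimax : CorrectorMinimax := by
  sorry

/-- STUB 2 (size M; TRUE, provable now — closes with the shared support item HomogeneousInvariance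
stmt-AtomisticToContinuum-9621 (`Φ.lawAt G_N t = G_N`) + `HardSphereFlow.measurable_flow`; Liouville preservation
`HardSphereFlow.measurePreserving`, energy/momentum conservation on the good set, good set conull and invariant;
`localGibbsLaw = liouville.withDensity (canonicalDensity)`). Sources: Alexander1975, CIP1994 §4.2, GST2013 Prop. 4.1.1. -/
theorem stub_gibbsFlowInvariance : GibbsFlowInvariance := by
  sorry

/-- STUB 3 (size L; TRUE, unconditional). Sources: Diaconis–Freedman, Ann. IHP B 23 (1987) 397–423 (sphere
marginals vs Gaussian); Dembo–Zeitouni Thm 2.2.30 (Cramér in ℝ^d) and Thm 4.3.1 (Varadhan); KipnisLandim1999 App. 1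
§8; the refuters' energy-shell DV floor notes on stmt-5895/14135 (κ < 0.489 / 0.977). Mathlib: `condExp`,
`ProbabilityTheory.stdGaussian`, `MeasureTheory.Measure.tilted`. -/
theorem stub_thermodynamicSliceFloor : ThermodynamicSliceFloor := by
  sorry

/-- STUB 4 (size XL; OPEN — the HARDEST, carries the kinetic-chaos content of the crux in dual clothes: uniformity
in `N` of the rigidity of almost-invariant finite-`N` states; false iff a family `ρ_N` of Cesàro-averaged biased states
with `𝔄(ρ_N) = o(N)` and extensive excess exists, i.e. iff shared 10967 fails — a hidden extensive quasi-local charge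
overlapping a fast one-body `g`). Sources: OllaVaradhanYau1993 §3; KipnisLandim1999 Ch. 7 Thm 1.1 (nongradient
correctors); Kifer1990 (LD bounds as sup over invariant measures); Villani2003 doi:10.1007/s00220-002-0777-1
(entropy production vs entropy); Simanyi2013 doi:10.1088/0951-7715/26/6/1703; BGSSAnnals2023 (LD over Lanford time). -/
theorem stub_almostInvariantRigidity : AlmostInvariantRigidity := by
  sorry

/-! ## Composition (sorry-free) -/

/-- **C⁺ from the anchor and the conditional rigidity** (quantifier merging, proved): `σ₀ := min`, `κ := min`
(so `|g| ≤ κ` serves both stubs), `τ₀` from the rigidity, `N₀ := max`, and for each state the anchor is invoked at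
`δ/2` on the state's thermodynamic profile and fed to the rigidity. -/
theorem statewiseDuality_of_parts (h₂ : GibbsFlowInvariance) (h₃ : ThermodynamicSliceFloor)
    (h₄ : AlmostInvariantRigidity) : StatewiseDuality := by
  intro a θ u₀ ha hθ
  obtain ⟨σ₃, hσ₃, H₃⟩ := h₃ a θ u₀ ha hθ
  obtain ⟨σ₄, hσ₄, H₄⟩ := h₄ h₂ a θ u₀ ha hθ
  refine ⟨min σ₃ σ₄, lt_min hσ₃ hσ₄, fun σ hσ hσlt => ?_⟩
  obtain ⟨κ₃, hκ₃, G₃⟩ := H₃ σ hσ (lt_of_lt_of_le hσlt (min_le_left _ _))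
  obtain ⟨κ₄, hκ₄, G₄⟩ := H₄ σ hσ (lt_of_lt_of_le hσlt (min_le_right _ _))
  refine ⟨min κ₃ κ₄, lt_min hκ₃ hκ₄, fun φ g hφ hg hφ1 hgκ horth δ hδ => ?_⟩
  have hg₃ : ∀ v, |g v| ≤ κ₃ := fun v => (hgκ v).trans (min_le_left _ _)
  have hg₄ : ∀ v, |g v| ≤ κ₄ := fun v => (hgκ v).trans (min_le_right _ _)
  obtain ⟨τ₀, hτ₀, N₄, K₄⟩ := G₄ φ g hφ hg hφ1 hg₄ horth δ hδ
  obtain ⟨N₃, K₃⟩ := G₃ φ g hφ hg hφ1 hg₃ horth (δ / 2) (half_pos hδ)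
  refine ⟨τ₀, hτ₀, max N₃ N₄, fun N hN Φ => ?_⟩
  obtain ⟨lag, hlag, M, hM, R⟩ := K₄ N ((le_max_right _ _).trans hN) Φ
  refine ⟨lag, hlag, M, hM, fun ρ hρm hρ0 hρC hρ1 => ?_⟩
  obtain ⟨f, hfm, hf0, hfC, htest, hfloor⟩ := K₃ N ((le_max_left _ _).trans hN) Φ ρ hρm hρ0 hρC hρ1
  exact R ρ hρm hρ0 hρC hρ1 f hfm hf0 hfC htest hfloor

/-- Measurability of the crux's one-body observable (continuity; `Config` over the torus is a Borel space). -/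
theorem measurable_fluxObs {θ : ℝ} {u₀ : V3} {φ : T3 → ℝ} {g : V3 → ℝ} (hφ : Continuous φ)
    (hg : Continuous g) (N : ℕ) : Measurable (fluxObs θ u₀ φ g N) := by
  refine Continuous.measurable ?_
  unfold fluxObs
  fun_prop

/-- The crux's one-body observable is bounded by `(N+1)κ`. -/
theorem abs_fluxObs_le {θ κ : ℝ} {u₀ : V3} {φ : T3 → ℝ} {g : V3 → ℝ} (hφ1 : ∀ x, |φ x| ≤ 1)
    (hgκ : ∀ v, |g v| ≤ κ) (N : ℕ) (z : Phase N) : |fluxObs θ u₀ φ g N z| ≤ (N + 1) * κ := by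
  have hκ : 0 ≤ κ := (abs_nonneg _).trans (hgκ 0)
  calc |fluxObs θ u₀ φ g N z|
      ≤ ∑ i, |φ (z i).1 * g ((Real.sqrt θ)⁻¹ • ((z i).2 - u₀))| := Finset.abs_sum_le_sum_abs _ _
    _ ≤ ∑ _i : Fin (N + 1), κ := by
        refine Finset.sum_le_sum fun i _ => ?_
        rw [abs_mul]
        calc |φ (z i).1| * |g ((Real.sqrt θ)⁻¹ • ((z i).2 - u₀))|
            ≤ 1 * κ := mul_le_mul (hφ1 _) (hgκ _) (abs_nonneg _) zero_le_one
          _ = κ := one_mul κ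
    _ = (N + 1) * κ := by simp

/-- **Composition of the line** (proved): the exact minimax (stub 1) at `X = Phase N`, `μ = G_N` (a probability
measure for `σ ≤ 1/2`: tree theorem `isProbabilityMeasure_localGibbsLaw`), `T = Φ.flow lag` (measure-preserving by
stub 2), `F = fluxObs` (continuous, `|F| ≤ (N+1)κ`), `c = 4/h₀`, `K = e^{δ(N+1)}`, `B = δ(N+1)`, fed with the
per-state witnesses of `StatewiseDuality`, IS the crux (body spelled with the reducible frame abbreviations). -/
theorem correctorPressureDecay_of_parts (h₁ : CorrectorMinimax) (h₂ : GibbsFlowInvariance)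
    (h : StatewiseDuality) :
    ∀ (a θ : ℝ) (u₀ : V3), 0 < a → 0 < θ → ∃ σ₀ : ℝ, 0 < σ₀ ∧ ∀ σ : ℝ, 0 < σ → σ < σ₀ →
      (∀ (N : ℕ) (Φ : Flow σ N), IsProbabilityMeasure (gibbs σ a θ u₀ N Φ)) ∧
      ∃ κ : ℝ, 0 < κ ∧ ∀ (φ : T3 → ℝ) (g : V3 → ℝ), Continuous φ → Continuous g →
        (∀ x, |φ x| ≤ 1) → (∀ v, |g v| ≤ κ) →
        (∀ (c₀ c₂ : ℝ) (b : V3),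
          ∫ v, g v * (c₀ + inner ℝ b v + c₂ * ‖v‖ ^ 2) ∂(ProbabilityTheory.stdGaussian V3) = 0) →
        ∀ δ : ℝ, 0 < δ → ∃ τ₀ : ℝ, 0 < τ₀ ∧ ∃ N₀ : ℕ, ∀ N : ℕ, N₀ ≤ N → ∀ Φ : Flow σ N,
          ∃ lag : ℝ, 0 < lag ∧ ∃ W : Phase N → ℝ, Measurable W ∧ (∃ C : ℝ, ∀ z, |W z| ≤ C) ∧
            ∫⁻ z, ENNReal.ofReal (Real.exp (2 * ((∑ i, φ (z i).1 * g ((Real.sqrt θ)⁻¹ • ((z i).2 - u₀))) -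
                lag⁻¹ * (W (Φ.flow lag z) - W z)))) ∂(gibbs σ a θ u₀ N Φ)
              ≤ ENNReal.ofReal (Real.exp (δ * (N + 1))) ∧
            ∫⁻ z, ENNReal.ofReal (Real.exp (4 * (τ₀ * ((N + 1 : ℕ) : ℝ) ^ (-(1 / 3 : ℝ)))⁻¹ * |W z|))
                ∂(gibbs σ a θ u₀ N Φ) ≤ ENNReal.ofReal (Real.exp (δ * (N + 1))) := by
  intro a θ u₀ ha hθ
  obtain ⟨σ₁, hσ₁, H⟩ := h a θ u₀ ha hθ
  refine ⟨min σ₁ (1 / 2), lt_min hσ₁ (by norm_num), fun σ hσ hσlt => ?_⟩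
  have hσ₁' : σ < σ₁ := lt_of_lt_of_le hσlt (min_le_left _ _)
  have hσhalf : σ ≤ 1 / 2 := (lt_of_lt_of_le hσlt (min_le_right _ _)).le
  have hP : ∀ (N : ℕ) (Φ : Flow σ N), IsProbabilityMeasure (gibbs σ a θ u₀ N Φ) := fun N Φ =>
    Literature.MathematicalPhysics.KineticTheory.isProbabilityMeasure_localGibbsLaw
      continuous_const continuous_const continuous_const (fun _ => ha) (fun _ => hθ) hσhalf N Φ
  refine ⟨hP, ?_⟩
  obtain ⟨κ, hκ, Hκ⟩ := H σ hσ hσ₁'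
  refine ⟨κ, hκ, fun φ g hφ hg hφ1 hgκ horth δ hδ => ?_⟩
  obtain ⟨τ₀, hτ₀, N₀, HN⟩ := Hκ φ g hφ hg hφ1 hgκ horth δ hδ
  refine ⟨τ₀, hτ₀, N₀, fun N hN Φ => ?_⟩
  obtain ⟨lag, hlag, M, hM, Hρ⟩ := HN N hN Φ
  haveI := hP N Φ
  have hT : MeasurePreserving (Φ.flow lag) (gibbs σ a θ u₀ N Φ) (gibbs σ a θ u₀ N Φ) :=
    h₂ σ a θ u₀ hσ ha hθ N Φ lag
  have hFm : Measurable (fluxObs θ u₀ φ g N) := measurable_fluxObs hφ hg N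
  have hFb : ∃ C : ℝ, ∀ z, |fluxObs θ u₀ φ g N z| ≤ C := ⟨(N + 1) * κ, abs_fluxObs_le hφ1 hgκ N⟩
  have hc : 0 < 4 * (τ₀ * ((N + 1 : ℕ) : ℝ) ^ (-(1 / 3 : ℝ)))⁻¹ := by positivity
  obtain ⟨W, hWm, hWM, hcost, hdef⟩ :=
    h₁ (Phase N) (gibbs σ a θ u₀ N Φ) (Φ.flow lag) hT (fluxObs θ u₀ φ g N) hFm hFb lag
      (4 * (τ₀ * ((N + 1 : ℕ) : ℝ) ^ (-(1 / 3 : ℝ)))⁻¹) M (δ * (N + 1))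
      (ENNReal.ofReal (Real.exp (δ * (N + 1)))) hlag hc hM Hρ
  exact ⟨lag, hlag, W, hWm, ⟨M, hWM⟩, hdef, hcost⟩

/-- **The skeleton concludes the crux BY NAME.** `CorrectorPressureDecay` (route `AntiMazurCoboundaries`,
stmt-AtomisticToContinuum-14135) from the four registered stubs. -/
theorem CorrectorPressureDecay_of : CorrectorPressureDecay :=
  correctorPressureDecay_of_parts stub_correctorMinimax stub_gibbsFlowInvariance
    (statewiseDuality_of_parts stub_gibbsFlowInvariance stub_thermodynamicSliceFloor
      stub_almostInvariantRigidity)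

end Summit.AtomisticToContinuum.HydrodynamicLimit.Cruxes.CorrectorPressureDecay.AlmostInvariantDuality

end
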